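import Summits.Ventures.HodgeRepro2.T5UnitaryHeckeAdjoint

/-!
# T5AntidiagonalForm — the antidiagonal Gram matrices of the record, the dictionary with Mathlib's
`unitaryGroup`, and the side hypotheses of T5UnitaryGroupForm discharged for them

Blind cell pub-hodge-repro2, seat p8, Tier-5 kernel support (continuation of T5UnitaryGroupForm /
T5UnitaryHeckeAdjoint).

* `antidiagonalMatrix d : Matrix (Fin n) (Fin n) E` — `d i` at `(i, rev i)`, `0` elsewhere; for the record's
  hermitian space of dimension `3` at an inert place the Gram matrix in a basis `e, e₀, f` of a self-dual
  lattice is `antidiagonalMatrix ![1, u, 1]` (`⟨e, f⟩ = 1`, `⟨e₀, e₀⟩ = u` a unit).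
* The side hypotheses of T5UnitaryGroupForm hold for it: persymmetry `J (rev i) (rev j) = J i j` when
  `d ∘ rev = d` (`antidiagonalMatrix_rev_rev`), support on the graph of `rev`
  (`antidiagonalMatrix_ne_zero_imp`), hermitian when `star (d (rev i)) = d i` (`isHermitian_antidiagonalMatrix`);
  `![1, u, 1]` satisfies `d ∘ rev = d` (`vec3_rev`).
* `mem_formUnitaryGroup_one_iff` — for `J = 1`, `U(J)` is Mathlib's `Matrix.unitaryGroup` (the dictionary with
  the Mathlib notion; `star M = Mᴴ`).
* `heckeAlgebra_mul_comm_antidiagonal`, `diagonalUnit_zpow_mem_antidiagonal` — T5UnitaryGroupForm /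
  T5UnitaryHeckeAdjoint instantiated at `J = antidiagonalMatrix d`, `σ = Fin.rev`: `H(U(J), K_U)` is commutative
  modulo the printed Cartan decomposition, and the torus `diag(ϖ^{m})` lies in `U(J)`.

The Cartan decomposition stays the explicit hypothesis `IsCartanDecomposition`; nothing else is assumed.
-/

namespace Summit.Ventures.HodgeRepro2.T5AntidiagonalForm

open Summit.Ventures.HodgeRepro2 Matrix

section Matrices

variable {E : Type*} [CommRing E] {n : ℕ}

/-- The antidiagonal matrix with entry `d i` at `(i, rev i)` and `0` elsewhere. -/
def antidiagonalMatrix (d : Fin n → E) : Matrix (Fin n) (Fin n) E :=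
  Matrix.of fun i j => if j = Fin.rev i then d i else 0

/-- Entries of `antidiagonalMatrix`. -/
theorem antidiagonalMatrix_apply (d : Fin n → E) (i j : Fin n) :
    antidiagonalMatrix d i j = if j = Fin.rev i then d i else 0 := rfl

/-- The antidiagonal entry. -/
theorem antidiagonalMatrix_apply_rev (d : Fin n → E) (i : Fin n) :
    antidiagonalMatrix d i (Fin.rev i) = d i := by
  simp [antidiagonalMatrix_apply]

/-- `antidiagonalMatrix d` is supported on the graph of `rev`: a non-zero entry `(i, j)` has `j = rev i`
(the hypothesis `hJσ` of T5UnitaryGroupForm's `diagonalUnit_zpow_mem_formUnitaryGroup`). -/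
theorem antidiagonalMatrix_ne_zero_imp (d : Fin n → E) {i j : Fin n} (h : antidiagonalMatrix d i j ≠ 0) :
    j = Fin.revPerm i := by
  by_contra hne
  apply h
  simp only [Fin.revPerm_apply] at hne
  simp [antidiagonalMatrix_apply, hne]

/-- PERSYMMETRY: `J (rev i) (rev j) = J i j` for `J = antidiagonalMatrix d` when `d ∘ rev = d`
(the hypothesis `hJ` of T5UnitaryGroupForm — the Weyl element `P_rev` lies in `U(J)`). -/
theorem antidiagonalMatrix_rev_rev (d : Fin n → E) (hd : ∀ i, d (Fin.rev i) = d i) (i j : Fin n) :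
    antidiagonalMatrix d (Fin.revPerm i) (Fin.revPerm j) = antidiagonalMatrix d i j := by
  simp only [Fin.revPerm_apply, antidiagonalMatrix_apply, Fin.rev_rev, hd]
  by_cases hij : j = Fin.rev i
  · subst hij
    simp
  · have : ¬ Fin.rev j = i := fun h => hij (by rw [← h, Fin.rev_rev])
    simp [hij, this]

/-- `antidiagonalMatrix d` is hermitian when `star (d (rev i)) = d i`. -/
theorem isHermitian_antidiagonalMatrix [StarRing E] (d : Fin n → E)
    (hd : ∀ i, star (d (Fin.rev i)) = d i) : (antidiagonalMatrix d).IsHermitian := by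
  ext i j
  simp only [conjTranspose_apply, antidiagonalMatrix_apply]
  by_cases hij : j = Fin.rev i
  · subst hij
    simp [hd]
  · have : ¬ i = Fin.rev j := fun h => hij (by rw [h, Fin.rev_rev])
    simp [hij, this]

/-- The record's Gram vector `![1, u, 1]` (dimension `3`: `⟨e, f⟩ = 1`, `⟨e₀, e₀⟩ = u`) is `rev`-symmetric. -/
theorem vec3_rev (u : E) : ∀ i : Fin 3, (![1, u, 1] : Fin 3 → E) (Fin.rev i) = ![1, u, 1] i := by
  intro i
  fin_cases i <;> rfl

end Matrices

section MathlibDictionary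

variable {E : Type*} [CommRing E] [StarRing E] {ι : Type*} [Fintype ι] [DecidableEq ι]

/-- DICTIONARY WITH MATHLIB: for `J = 1` the group `U(1) = {g | gᴴ g = 1}` is Mathlib's `Matrix.unitaryGroup`
(on the underlying matrices; `star M = Mᴴ`). -/
theorem mem_formUnitaryGroup_one_iff (g : GL ι E) :
    g ∈ T5UnitaryGroupForm.formUnitaryGroup (1 : Matrix ι ι E) ↔
      (g : Matrix ι ι E) ∈ Matrix.unitaryGroup ι E := by
  rw [T5UnitaryGroupForm.mem_formUnitaryGroup_iff, Matrix.mem_unitaryGroup_iff', star_eq_conjTranspose,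
    Matrix.mul_one]

end MathlibDictionary

section Record

variable {R : Type*} [CommRing R] {E : Type*} [Field E] [StarRing E] [Algebra R E] {n : ℕ}

/-- The torus `diag(ϖ^{m})` (`m ∘ rev = −m`, `ϖ` fixed by the involution) lies in `U(antidiagonalMatrix d)`. -/
theorem diagonalUnit_zpow_mem_antidiagonal (d : Fin n → E) (ϖ : Eˣ) (hϖ : star (ϖ : E) = ϖ) (m : Fin n → ℤ)
    (hm : ∀ i, m (Fin.revPerm i) = - m i) :
    T5CartanUniformiser.diagonalUnit (fun i => ϖ ^ m i) ∈
      T5UnitaryGroupForm.formUnitaryGroup (antidiagonalMatrix d) :=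
  T5UnitaryGroupForm.diagonalUnit_zpow_mem_formUnitaryGroup (antidiagonalMatrix d) Fin.revPerm ϖ hϖ
    (fun _ _ h => antidiagonalMatrix_ne_zero_imp d h) m hm

/-- The Weyl element `P_rev` lies in `U(antidiagonalMatrix d)` when `d ∘ rev = d`. -/
theorem permUnit_rev_mem_antidiagonal (d : Fin n → E) (hd : ∀ i, d (Fin.rev i) = d i) :
    T5CartanDominant.permUnit E Fin.revPerm ∈ T5UnitaryGroupForm.formUnitaryGroup (antidiagonalMatrix d) :=
  T5UnitaryGroupForm.permUnit_mem_formUnitaryGroup _ _ (antidiagonalMatrix_rev_rev d hd)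

variable [IsDomain R] [IsFractionRing R E] [IsDiscreteValuationRing R]
  [Finite (IsLocalRing.ResidueField R)]

/-- `H(U(J), K_U)` IS COMMUTATIVE for `J = antidiagonalMatrix d` with `d ∘ rev = d` (the record's
`antidiag(1, u, 1)`), `R` a DVR with finite residue field, MODULO the printed Cartan decomposition
`IsCartanDecomposition R J Fin.revPerm ϖ`. -/
theorem heckeAlgebra_mul_comm_antidiagonal (d : Fin n → E) (hd : ∀ i, d (Fin.rev i) = d i) (ϖ : Eˣ)
    (h : T5UnitaryHeckeAdjoint.IsCartanDecomposition R (antidiagonalMatrix d) Fin.revPerm ϖ)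
    (k : Type*) [Field k]
    (T S : T5HeckePermutationModule.heckeAlgebra k
      (T5UnitaryHeckeAdjoint.hyperspecialSubgroup R (antidiagonalMatrix d))) :
    T * S = S * T :=
  T5UnitaryHeckeAdjoint.heckeAlgebra_mul_comm (antidiagonalMatrix_rev_rev d hd) h k T S

/-- The same for the record's three-dimensional Gram matrix `antidiag(1, u, 1)`. -/
theorem heckeAlgebra_mul_comm_antidiag_one_u_one (u : E) (ϖ : Eˣ)
    (h : T5UnitaryHeckeAdjoint.IsCartanDecomposition R (antidiagonalMatrix ![1, u, 1]) Fin.revPerm ϖ)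
    (k : Type*) [Field k]
    (T S : T5HeckePermutationModule.heckeAlgebra k
      (T5UnitaryHeckeAdjoint.hyperspecialSubgroup R (antidiagonalMatrix ![1, u, 1]))) :
    T * S = S * T :=
  heckeAlgebra_mul_comm_antidiagonal ![1, u, 1] (vec3_rev u) ϖ h k T S

end Record

end Summit.Ventures.HodgeRepro2.T5AntidiagonalForm
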